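import Literature.AlgebraicGeometry.ShimuraVarieties.UnitaryCurveAuxiliaryPeriodLieType
import Literature.NumberTheory.ComplexMultiplication.CMTypeKottwitzCensusRankTwo
import Mathlib.LinearAlgebra.Charpoly.Basic
import HarnessLib

/-!
# The `Mρ_kottwitz` field of the auxiliary Siegel chart, discharged (E2 FILE D at the flipped conjugate type, E-line token shape)

Topic `AlgebraicGeometry/ShimuraVarieties`; namespace `Literature.AlgebraicGeometry.ShimuraVarieties.UnitaryCurve.AuxV`.  THEOREMS ONLY (no `def`, no named
fact, no instance, no notation, no `sorry`).  Cell `hodgecm-mathlib` (D-0151), FLOOR 0, P6 «MOD programme», door (E) of `stub_RGD`, E-line `F0_P6a_PELWitnessE`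
(GEN heir A-p18 (g31), M-23): the `AuxChartGS` field **(M) `Mρ_kottwitz`** — «`Mρ a b` is `ℂ`-linear for the complex structure of `Z a v` and its `ℂ`-linear
avatar on `Lie = ℂ^g` has characteristic polynomial `∏_φ (X − φ b)^{m φ}`, `m = mOf ι₁ Φ`».  `--supports stmt-HodgeConjecture-24832`, count-neutral; HC_CM is
proved only modulo the printed citations until rung 0 closes.

* `exists_linear_comm_siegelPeriodMap_charpoly_eq_prod_pow` — THE FIELD BODY at one `(a, v, b)`, token for token, from: the rank-2 frame `F` over the CM field
  `M` itself (`j = id`), a CM type `Φ ∋ ι₁` with the E-line's exponent function `m` axiomatised by its four values (`m = 1` on `{ι₁, ῑ₁}`, `0` on `Φ` off the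
  pair, `2` off `Φ` off the pair — GEN: `m := mOf ι₁ Φ`, each value by `simp [mOf]`), the mover frame `γ₀` with `γ₀ J_{Φ′}(v) γ₀⁻¹ = J(Z)` for the FLIPPED
  CONJUGATE TYPE `Φ′ := flip ι₁ (bar Φ) = {ι₁} ∪ conj(Φ ∖ {ι₁})` (★ `CMTypeOps.flip`∕`bar`; clause (Q) of ★ `exists_siegelChartGS_auxComplexStructureV_mover`), and a
  lattice reading `B : 𝓞 M →+* M_{2g}(ℤ)` with real avatar `(B b)_ℝ = conjJ γ₀ (auxRepV ℝ F (t, 1))`, `t = 1 ⊗ b` (★ E1 FILE 9 `exists_chartActionReading`, clause 2):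
  `∃ Cb, (∀ u, Cb (Π_Z u) = Π_Z ((B b)_ℝ u)) ∧ Cb.charpoly = ∏_φ (X − φ b)^{m φ}`.  Proof: ★ E2 FILE D `exists_lieAction_charpoly` (at `Φ′`, `n = 2`, `τ = ι₁`) +
  ★ A-p01 census `prod_lieCensus_flip_bar_eq_prod_pow` + ★ `siegelOfJ_jOfSiegel`; the case `b = 0` (no unit `t`) is `Cb := 0`, `charpoly 0 = X^g`, with
  `∑_φ m φ = g` READ OFF the case `b = 1` by degrees (no `g = [M:ℚ]` input).

## References
* [Kottwitz1992] R. Kottwitz, *Points on some Shimura varieties over finite fields*, JAMS 5 (1992), §5 p. 390 (determinant condition).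
* [RapoportSmithlingZhang2020Diagonal] M. Rapoport, B. Smithling, W. Zhang (2020), §3.2 (3.8) p. 11, Remark 3.6 (3.14) p. 13, §4.1 p. 17.
* [Lange2023AbelianVarietiesComplex] H. Lange, *Abelian Varieties over the Complex Numbers* (2023), §3.1.1 (analytic and rational representations).
* [Deligne1979ShimuraVarieties] P. Deligne, *Variétés de Shimura* (1979), Prop. 2.3.10 (PDF p. 32 of Milne's translation).
-/

set_option autoImplicit false

noncomputable section

open Matrix NumberField Polynomial
open scoped TensorProduct Polynomial Classical

namespace Literature.AlgebraicGeometry.ShimuraVarieties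

namespace UnitaryCurve

namespace AuxV

open Literature.AlgebraicGeometry.ModuliOfAbelianVarieties
open Literature.AlgebraicGeometry.ModuliOfAbelianVarieties.SiegelModuli
open Literature.AlgebraicGeometry.Motives (CMType)
open Literature.NumberTheory.Automorphic (siegelUpperHalfSpace)
open Literature.NumberTheory.Automorphic.UnitaryGroup
open Literature.NumberTheory.ComplexMultiplication.CMTypeOps (flip bar prod_lieCensus_flip_bar_eq_prod_pow)

variable {M : Type} [Field M] [NumberField M] [IsCMField M] {H : Matrix (Fin 2) (Fin 2) M} {ξ : M} {g : ℕ} {δ : Fin g → ℕ}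
  (F : SymplecticFrameV M (RingHom.id M) H ξ g δ) (ι₁ : M →+* ℂ) (Φ : CMType M)

/-- **THE `Mρ_kottwitz` FIELD BODY** (E-line `AuxChartGS`, field (M)): at the mover frame `γ₀` of a slice (`γ₀ J_{Φ′}(v) γ₀⁻¹ = J(Z)`, `Φ′ = flip ι₁ (bar Φ)`)
and for a lattice reading `B` with real avatar `(B b)_ℝ = conjJ γ₀ (auxRepV ℝ F (1 ⊗ b, 1))`, every `b ∈ 𝒪_M` acts `ℂ`-linearly on `Lie = (ℂ^g, Π_Z)` —
`Cb ∘ Π_Z = Π_Z ∘ (B b)_ℝ` — with characteristic polynomial **`∏_φ (X − φ b)^{m φ}`** for the rank-two Kottwitz signature `m` (`1` on `{ι₁, ῑ₁}`, `0` on `Φ` off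
the pair, `2` off `Φ` off the pair).  [cite: Kottwitz1992, §5 p. 390] [cite: RapoportSmithlingZhang2020Diagonal, §3.2 (3.8) p. 11 and Remark 3.6 (3.14) p. 13]
[cite: Lange2023AbelianVarietiesComplex, §3.1.1] [cite: Deligne1979ShimuraVarieties, Prop. 2.3.10 (PDF p. 32)] -/
theorem exists_linear_comm_siegelPeriodMap_charpoly_eq_prod_pow (hι : ι₁ ∈ Φ.1) (m : (M →+* ℂ) → ℕ)
    (h1 : m ι₁ = 1) (h1' : m (ComplexEmbedding.conjugate ι₁) = 1)
    (h0 : ∀ φ ∈ Φ.1, φ ≠ ι₁ → φ ≠ ComplexEmbedding.conjugate ι₁ → m φ = 0)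
    (h2 : ∀ φ ∉ Φ.1, φ ≠ ι₁ → φ ≠ ComplexEmbedding.conjugate ι₁ → m φ = 2)
    (hδ : ∀ i, 0 < δ i) (γ₀ : GL (Fin g ⊕ Fin g) ℝ) {v : Fin 2 → ℂ} (hv : v ∈ negCone (H.map ι₁))
    {Z : Matrix (Fin g) (Fin g) ℂ} (hZmem : Z ∈ siegelUpperHalfSpace g)
    (hQ : conjJ γ₀ (auxComplexStructureV F ι₁ (flip ι₁ (bar Φ)) v) = jOfSiegel δ Z)
    {B : 𝓞 M →+* Matrix (Fin g ⊕ Fin g) (Fin g ⊕ Fin g) ℤ}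
    (hB : ∀ (b : 𝓞 M) (t : (ℝ ⊗[ℚ] M)ˣ), (t : ℝ ⊗[ℚ] M) = (1 : ℝ) ⊗ₜ[ℚ] ((b : 𝓞 M) : M) →
      (B b).map (Int.cast : ℤ → ℝ) = conjJ γ₀ ((auxRepV ℝ F (t, 1) : GL (Fin g ⊕ Fin g) ℝ) : Matrix (Fin g ⊕ Fin g) (Fin g ⊕ Fin g) ℝ))
    (b : 𝓞 M) :
    ∃ Cb : (Fin g → ℂ) →ₗ[ℂ] (Fin g → ℂ),
      (∀ u : Fin g ⊕ Fin g → ℝ, Cb (siegelPeriodMap δ Z u) = siegelPeriodMap δ Z (((B b).map (Int.cast : ℤ → ℝ)) *ᵥ u)) ∧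
      Cb.charpoly = ∏ φ : M →+* ℂ, (Polynomial.X - Polynomial.C (φ ((b : 𝓞 M) : M))) ^ (m φ) := by
  have hC0 : conjJ γ₀ (auxComplexStructureV F ι₁ (flip ι₁ (bar Φ)) v) ∈ C0 δ := by
    rw [hQ]; exact jOfSiegel_mem_C0 hδ hZmem
  have hZv : periodZV M F (flip ι₁ (bar Φ)) ι₁ γ₀ v = Z := by
    rw [periodZV, hQ, siegelOfJ_jOfSiegel hδ hZmem]
  -- the census at the flipped conjugate type, `n = 2`, `j = id`
  have hcen : ∀ b' : M,
      (∏ ρ : (flip ι₁ (bar Φ)).1, if ρ.1.comp (RingHom.id M) = ι₁ then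
          (Polynomial.X - Polynomial.C (ComplexEmbedding.conjugate ρ.1 b')) * (Polynomial.X - Polynomial.C (ρ.1 b')) ^ (2 - 1)
          else (Polynomial.X - Polynomial.C (ρ.1 b')) ^ 2) =
        ∏ φ : M →+* ℂ, (Polynomial.X - Polynomial.C (φ b')) ^ (m φ) := by
    intro b'
    rw [← prod_lieCensus_flip_bar_eq_prod_pow Φ hι m h1 h1' h0 h2 b']
    refine Finset.prod_congr rfl fun ρ _ => ?_
    rw [RingHom.comp_id]
  -- the unit case through E2 FILE D
  have hunit : ∀ (b' : 𝓞 M) (t : (ℝ ⊗[ℚ] M)ˣ), (t : ℝ ⊗[ℚ] M) = (1 : ℝ) ⊗ₜ[ℚ] ((b' : 𝓞 M) : M) →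
      ∃ Cb : (Fin g → ℂ) →ₗ[ℂ] (Fin g → ℂ),
        (∀ u : Fin g ⊕ Fin g → ℝ, Cb (siegelPeriodMap δ Z u) = siegelPeriodMap δ Z (((B b').map (Int.cast : ℤ → ℝ)) *ᵥ u)) ∧
        Cb.charpoly = ∏ φ : M →+* ℂ, (Polynomial.X - Polynomial.C (φ ((b' : 𝓞 M) : M))) ^ (m φ) := by
    intro b' t ht
    obtain ⟨Cb, hCb, hchar⟩ := exists_lieAction_charpoly M F (flip ι₁ (bar Φ)) ι₁ hδ γ₀ hv hC0 t ((b' : 𝓞 M) : M) ht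
    refine ⟨Cb, fun u => ?_, hchar.trans (hcen _)⟩
    rw [← hZv, hB b' t ht]
    exact hCb u
  by_cases hb : ((b : 𝓞 M) : M) = 0
  · -- `b = 0`: `Cb = 0`, `charpoly 0 = X ^ g = X ^ (∑ m)`, the count `∑ m = g` read off `b = 1`
    have hb0 : b = 0 := RingOfIntegers.ext (by rw [hb]; exact (map_zero (algebraMap (𝓞 M) M)).symm)
    obtain ⟨C₁, -, hchar₁⟩ := hunit 1 1 (by rw [Units.val_one, RingOfIntegers.coe_eq_algebraMap, map_one, Algebra.TensorProduct.one_def])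
    have hsum : ∑ φ : M →+* ℂ, m φ = g := by
      have hdeg := congrArg Polynomial.natDegree hchar₁
      rw [LinearMap.charpoly_natDegree, Module.finrank_fin_fun] at hdeg
      rw [hdeg, Polynomial.natDegree_prod _ _ fun φ _ => pow_ne_zero _ (Polynomial.X_sub_C_ne_zero _)]
      refine Finset.sum_congr rfl fun φ _ => ?_
      rw [Polynomial.natDegree_pow, Polynomial.natDegree_X_sub_C, mul_one]
    refine ⟨0, fun u => ?_, ?_⟩
    · rw [LinearMap.zero_apply, hb0, map_zero, Matrix.map_zero Int.cast Int.cast_zero, Matrix.zero_mulVec, map_zero]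
    · rw [LinearMap.charpoly_zero, Module.finrank_fin_fun, ← hsum, ← Finset.prod_pow_eq_pow_sum]
      refine Finset.prod_congr rfl fun φ _ => ?_
      rw [hb, map_zero, map_zero, sub_zero]
  · obtain ⟨t, ht⟩ := exists_unit_coe_eq_one_tmul M _ hb
    exact hunit b t ht

end AuxV

end UnitaryCurve

end Literature.AlgebraicGeometry.ShimuraVarieties

end
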